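import Summits.CriticalPhenomena.SAWScalingLimit.Theorems.SAWTotalPositivityCriticalBubbleBoundJoinLedger
import Summits.CriticalPhenomena.SAWScalingLimit.Theorems.SAWTotalPositivityCriticalBubbleBoundJoinSummable
import Summits.CriticalPhenomena.SAWScalingLimit.Theorems.SAWTotalPositivityCriticalBubbleBoundJoinArches
import Summits.CriticalPhenomena.SAWScalingLimit.Theorems.SAWTotalPositivityCriticalBubbleBoundJoinRooted
import Summits.CriticalPhenomena.SAWScalingLimit.Theorems.SAWTotalPositivityCriticalBubbleBoundJoinRarity
import Summits.CriticalPhenomena.SAWScalingLimit.Theorems.SAWTotalPositivityCriticalBubbleBoundJoinTail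
import Summits.CriticalPhenomena.SAWScalingLimit.Theorems.SAWTotalPositivityCriticalBubbleBoundJoinInjection
import Summits.CriticalPhenomena.SAWScalingLimit.Theorems.SAWTotalPositivityCriticalBubbleBoundJoinEntropy
import Summits.CriticalPhenomena.SAWScalingLimit.Theorems.SAWTotalPositivityCriticalBubbleBoundJoinMoments
import Summits.CriticalPhenomena.SAWScalingLimit.Theorems.SAWTotalPositivityCriticalBubbleBoundJoinDensity
import Summits.CriticalPhenomena.SAWScalingLimit.Theorems.CriticalBubbleBound.Negative.CriticalBubbleBoundUnrootedPolygons

/-!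
# The JOIN-MASS BOOTSTRAP (line `docking-census-joining`, crux `SAWTotalPositivity.CriticalBubbleBound`,
stmt-CriticalPhenomena-7117; lead prover c6): assembly

Hammond's polygon joining (Ann. Probab. 46 (2018) §4) in `x_c`-MASS form, run through the docking
line's landed ledger `Docking.stub_ledgerBootstrap` at `(κ, π, b) = (3/2, 0, 1)` for the 17-shifted
class sequence `jterm`:

* ENTROPY `Dent_ge` (tall/left classes of size `≍ 2^i` are Madras-joinable at `≳ 2^{i/2}` admissible
  offsets; Lemma 4.9/4.11), INJECTION `Dent_le_Urar` (the junction plaquette of the join is a GLOBAL join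
  plaquette of the re-rooted join and, with the two case tags, determines the arrow), RARITY
  `Urar_le_of_tail` + `gjoins_tail_bound` (Prop. 4.5: global join plaquettes are exponentially few — an
  unfolding into bridges);
* `joinMass_blockDecay`: `R'_i ≤ C_s 2^{s i}` for every `s > -1/2` (the fixed point `2^{-i/2}` of one
  sliding direction: "θ ≥ 3/2" in block average for the class masses);
* CONSEQUENCES: `join_tsum_cterm_ne_top'` (the class series is finite), `join_unrootedPolygonSeries_ne_top`
  (`𝒫 = Σ_N q_N x_c^N < ∞`, Disproof §21's rung `M₀`: "θ > 1 summably"), `join_halfPlaneBubbleFinite`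
  (`Negative.HalfPlaneBubbleFinite`: the critical half-plane bubble `A` of `ℤ²` is finite — the route's
  foreseen layer-2 child `HalfPlaneBubble`), `join_tsum_rpow_cterm_ne_top` (the class moment series
  `Σ_n (n+1)^t cterm n` is finite for every `t < 1/2`), and in crux currency `join_blockMass_term_le`
  (`blockMass term i ≤ C_s 2^{s i}` for every `s > 1/2`: block-averaged `θ ≥ 3/2 - ε` for the rooted series
  `t_n = c_n(0,e₀) x_c^n`, whose summability — `θ > 2` — is the crux and stays open);
* DENSITY FORM (Hammond's published shape): `join_sparse_cterm` / `join_sparse_term` — the lengths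
  `n < 2^I` with `q_{n+1} x_c^{n+1} > (n+1)^{-3/2+ε}` (resp. `t_n > (n+1)^{-1/2+ε}`) are `O(2^{(1-ε/2)I})`;
* NOT A DOOR: a rarity GAIN `π > 0` for `Urar` as defined (root / right-column globalness) is
  false — a unit-square "ear" carrying the right column is a global join plaquette of positive
  density —, so `π = 0` (`Urar_le_of_tail`) is sharp here; a gain needs MACROSCOPIC globalness (both
  flipped halves of size `≍ 2^i`, which the join's images have): the next cycle's target.
-/

noncomputable section

open Literature.Probability.LatticeModels
open Literature.Probability.RandomPlanarGeometry Literature.Probability.RandomPlanarGeometry.SAW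
open scoped BigOperators ENNReal
open Summit.CriticalPhenomena.SAWScalingLimit.Theorems.CriticalBubbleBound.Negative
open Summit.CriticalPhenomena.SAWScalingLimit.Theorems.CriticalBubbleBound.Docking

namespace Summit.CriticalPhenomena.SAWScalingLimit.Theorems.CriticalBubbleBound.Join

/-- The entropy mass fed to the ledger is `Dent` truncated below scale `5` (where the injection
`Dent_le_Urar` is not available: the block `[16,32)` contains the one-edge class); the docking-entropy
inequality survives from scale `max i₀ 5` on and the injection inequality holds at every scale.
[cite: Hammond2015SAPJoining, Lemma 4.12] -/
theorem truncatedDent_spec {c : ℝ} {i₀ : ℕ}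
    (hent : ∀ i : ℕ, i₀ ≤ i → c * (2 : ℝ) ^ ((1 / 2 : ℝ) * (i : ℝ)) * blockMass jterm i ^ 2 ≤ Dent i) :
    (∀ i : ℕ, max i₀ 5 ≤ i →
        c * (2 : ℝ) ^ ((1 / 2 : ℝ) * (i : ℝ)) * blockMass jterm i ^ 2 ≤
          (fun i => if 5 ≤ i then Dent i else 0) i) ∧
      (∀ i : ℕ, (fun i => if 5 ≤ i then Dent i else 0) i ≤ 64 * criticalFugacity⁻¹ ^ 16 * Urar i) := by
  have hK₁ : (0 : ℝ) < 64 * criticalFugacity⁻¹ ^ 16 :=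
    mul_pos (by norm_num) (pow_pos (inv_pos.2 criticalFugacity_pos_lt_one'.1) 16)
  refine ⟨fun i hi => ?_, fun i => ?_⟩
  · have h5 : 5 ≤ i := le_trans (le_max_right _ _) hi
    dsimp only
    rw [if_pos h5]
    exact hent i (le_trans (le_max_left _ _) hi)
  · dsimp only
    split_ifs with h5
    · exact Dent_le_Urar i h5
    · exact mul_nonneg hK₁.le (Urar_nonneg i)

/-- **The join-mass bootstrap**: the dyadic block masses of the shifted class sequence decay like
`2^{s i}` for every `s > -1/2` (Hammond's exponents `(κ, π) = (1/2, 0)` in the unrooted ledger, i.e.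
`(3/2, 0)` in the ledger's normalisation). [cite: Hammond2015SAPJoining, Proposition 4.2 and Lemma 4.12] -/
theorem joinMass_blockDecay : ∀ s : ℝ, -(1 : ℝ) / 2 < s →
    ∃ C : ℝ, ∀ i : ℕ, blockMass jterm i ≤ C * (2 : ℝ) ^ (s * (i : ℝ)) := by
  obtain ⟨c, hc, i₀, hent⟩ := Dent_ge
  obtain ⟨A, ρ, hA, hρ0, hρ1, htail⟩ := gjoins_tail_bound
  obtain ⟨C, hrar⟩ := Urar_le_of_tail A ρ hA hρ0 hρ1 htail
  have hK₁ : (0 : ℝ) < 64 * criticalFugacity⁻¹ ^ 16 :=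
    mul_pos (by norm_num) (pow_pos (inv_pos.2 criticalFugacity_pos_lt_one'.1) 16)
  obtain ⟨hent', hinj⟩ := truncatedDent_spec hent
  exact join_ledger _ c (64 * criticalFugacity⁻¹ ^ 16) C (max i₀ 5) hc hK₁ hent' hinj hrar

/-- The class series `Σ_n #lexRooted n · x_c^{n+1}` (one term per translation class of self-avoiding
polygons of `ℤ²`) is FINITE. [cite: Hammond2015SAPJoining, Theorem 1.3 (averaged form)] -/
theorem join_tsum_cterm_ne_top' : ∑' n : ℕ, ENNReal.ofReal (cterm n) ≠ ⊤ := by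
  obtain ⟨C, hC⟩ := joinMass_blockDecay (-1 / 4) (by norm_num)
  exact join_tsum_cterm_ne_top ⟨C, -1 / 4, by norm_num, hC⟩

/-- **The critical half-plane bubble of `ℤ²` is finite**: `A = Σ_{arches 0 → e₀ in {y ≥ 0}} x_c^{|γ|} < ∞`
(the route's foreseen layer-2 child `HalfPlaneBubble`, Disproof §9's `A` in `bubble_chain : A ≤ S ≤ G`).
[cite: Hammond2015SAPJoining, Theorem 1.3 (averaged form)] -/
theorem join_halfPlaneBubbleFinite : HalfPlaneBubbleFinite := by
  rw [HalfPlaneBubbleFinite]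
  refine ne_top_of_le_ne_top ?_ halfPlaneBubble_le_tsum_cterm
  exact ENNReal.mul_ne_top ENNReal.ofReal_ne_top join_tsum_cterm_ne_top'

/-- **The unrooted critical polygon mass of `ℤ²` is finite**: `𝒫 = Σ_N q_N x_c^N < ∞` ("`θ > 1`
summably"; Madras–Slade Cor. 8.1.6(b) has only `Σ_{N ≤ M} q_N x_c^N = O(√M)`).
[cite: Hammond2015SAPJoining, Theorem 1.3 (averaged form)] -/
theorem join_unrootedPolygonSeries_ne_top : unrootedPolygonSeries ≠ ⊤ :=
  unrootedPolygonSeries_ne_top_of_halfPlaneBubbleFinite join_halfPlaneBubbleFinite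

/-- **Moments**: the class moment series `Σ_n (n+1)^t · #lexRooted n · x_c^{n+1}` is finite for every
`t < 1/2` (Disproof §25's moment ladder is finite strictly below the rung `1/2`; the crux sits at the
rung `1`). [cite: Hammond2015SAPJoining, Theorem 1.3 (averaged form)] -/
theorem join_tsum_rpow_cterm_ne_top : ∀ t : ℝ, t < 1 / 2 →
    ∑' n : ℕ, ENNReal.ofReal (((n : ℝ) + 1) ^ t * cterm n) ≠ ⊤ :=
  tsum_rpow_cterm_ne_top_of_blockDecay joinMass_blockDecay

/-- **Crux currency**: the rooted dyadic blocks `R_i = Σ_{n ∈ [2^i,2^{i+1})} c_n(0,e₀) x_c^n` are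
`O(2^{s i})` for every `s > 1/2` — block-averaged `θ ≥ 3/2 - ε` for the bubble series (the crux
`Σ_n c_n(0,e₀) x_c^n < ∞` needs `θ > 2`). [cite: Hammond2015SAPJoining, Theorem 1.3 (averaged form)] -/
theorem join_blockMass_term_le : ∀ s : ℝ, (1 : ℝ) / 2 < s →
    ∃ C : ℝ, ∀ i : ℕ, blockMass term i ≤ C * (2 : ℝ) ^ (s * (i : ℝ)) := by
  intro s hs
  obtain ⟨C, hC⟩ := joinMass_blockDecay (s - 1) (by linarith)
  obtain ⟨C', hC'⟩ := blockMass_term_le_of_jterm C (s - 1) hC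
  refine ⟨C', fun i => ?_⟩
  have := hC' i
  rwa [sub_add_cancel] at this

/-- Block decay of the class sequence itself: `Σ_{n ∈ B_i} q_{n+1} x_c^{n+1} ≤ C_s 2^{s i}` for every
`s > -1/2`. [cite: Hammond2015SAPJoining, Theorem 1.3 (averaged form)] -/
theorem join_blockMass_cterm_le : ∀ s : ℝ, -(1 : ℝ) / 2 < s →
    ∃ C : ℝ, ∀ i : ℕ, blockMass cterm i ≤ C * (2 : ℝ) ^ (s * (i : ℝ)) :=
  blockDecay_cterm_of_jterm joinMass_blockDecay

/-- **Hammond's theorem in density form, classes**: for every `0 < ε ≤ 1`, the lengths `n < 2^I`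
at which `q_{n+1} x_c^{n+1} > (n+1)^{-3/2+ε}` number at most `C_ε 2^{(1-ε/2) I}` — the polygon
number deficit satisfies `θ_n ≥ 3/2 - ε` off a set of lengths of density `O(2^{-ε I/2})`.
[cite: Hammond2015SAPJoining, Theorem 1.3] -/
theorem join_sparse_cterm : ∀ ε : ℝ, 0 < ε → ε ≤ 1 → ∃ C : ℝ, ∀ I : ℕ,
    ((((Finset.range (2 ^ I)).filter fun n : ℕ => ((n : ℝ) + 1) ^ (-(3 : ℝ) / 2 + ε) < cterm n).card : ℕ) : ℝ)
      ≤ C * (2 : ℝ) ^ ((1 - ε / 2) * (I : ℝ)) := by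
  intro ε hε hε1
  have e : (-(3 : ℝ) / 2 + ε) = (-(1 : ℝ) / 2 - 1 + ε) := by ring
  rw [e]
  exact sparse_exceed_of_blockDecay cterm (-(1 : ℝ) / 2) cterm_nonneg join_blockMass_cterm_le ε hε hε1

/-- **Hammond's theorem in density form, crux currency**: for every `0 < ε ≤ 1`, the lengths
`n < 2^I` at which `t_n = c_n(0,e₀) x_c^n > (n+1)^{-1/2+ε}` number at most `C_ε 2^{(1-ε/2) I}`
(the crux needs `Σ_n t_n < ∞`). [cite: Hammond2015SAPJoining, Theorem 1.3] -/
theorem join_sparse_term : ∀ ε : ℝ, 0 < ε → ε ≤ 1 → ∃ C : ℝ, ∀ I : ℕ,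
    ((((Finset.range (2 ^ I)).filter fun n : ℕ => ((n : ℝ) + 1) ^ (-(1 : ℝ) / 2 + ε) < term n).card : ℕ) : ℝ)
      ≤ C * (2 : ℝ) ^ ((1 - ε / 2) * (I : ℝ)) := by
  intro ε hε hε1
  have e : (-(1 : ℝ) / 2 + ε) = ((1 : ℝ) / 2 - 1 + ε) := by ring
  rw [e]
  exact sparse_exceed_of_blockDecay term ((1 : ℝ) / 2) term_nonneg join_blockMass_term_le ε hε hε1

end Summit.CriticalPhenomena.SAWScalingLimit.Theorems.CriticalBubbleBound.Join

end
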